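import Summits.CriticalPhenomena.PercolationContinuityZ3.Theorems.Transplant.FKConnectivityAllQWheelRimNegCorr
import Summits.CriticalPhenomena.PercolationContinuityZ3.Theorems.Transplant.FKConnectivityAllQWheelWordInv
import HarnessLib

/-!
# Connectivity correlation inequalities for `φ_{w,q}`, every `q > 0` — THEOREM W″: a RIM EDGE and a SPOKE of an apex-over-cycle weighted graph
# (every wheel `W_n`, any weights) are negatively correlated under `φ_{w,q}` for every `0 < q ≤ 1`

Support file (`--supports stmt-CriticalPhenomena-4575`), FK sub-lane `prim-bschramm-fk-3` (gen 8) of the post-continuity programme; builds on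
p205010 (kernel theorem, internal audit signed; external expert review pending).  No definitions, no named facts, no sorries; standard axioms.
Paper proof: bschramm/prim-bschramm-fk-3/WHEELS-HUB-NC.md §10 (every displayed identity machine-checked before formalisation).

**`FK.Wheel.wheel_negCorr_rim_spoke`** — hypotheses as in THEOREM W (`…AllQWheelNegCorr.lean`): `Fintype.card V = n + 1`, `n ≥ 3`, hub `x`, pairwise
distinct rim vertices `v 0, …, v (n−1)` (`≠ x`), `w` supported on the wheel pairs, `0 < q ≤ 1`.  Then for the rim pair `e = s(v y, v (y+1))` and the
spoke `f = s(x, v (y+d))`, `1 ≤ d ≤ n − 1` (every rim vertex except `v y`; `d = 1` is the incident spoke at `v (y+1)`, `d ≥ 2` the NON-INCIDENT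
ones — disjoint pairs of a 3-connected non-series-parallel graph), `φ_{w,q}(J_e ∩ J_f) ≤ φ_{w,q}(J_e)·φ_{w,q}(J_f)`.
With THEOREM W (spoke/spoke), THEOREM W′ (rim/rim, `…AllQWheelRimNegCorr.lean`) and fk-1 g7's `wheel_negCorr_at_rim` (the pairs at a rim vertex)
this covers EVERY pair of edges of every weighted wheel: wheels are Potts–Rayleigh for all `0 < q ≤ 1`.
PROOF (kernel, this file = assembly): LEMMA T and the slot decompositions `E(a) = a·1 + (1−a)·K`, `S(c) = (1−c)·1 + c·P` give
`Z = q·T(E(a), S(c))` for `T(X,Y) = Tr(X·A·Y·B) − (2−q)ρ_Aρ_B·X₀₀Y₁₁` (`transferT_two_slot_mixed`; `A = S(p_y)·seg(y+d+1, n−d−1)·E(r_{y+d})`,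
`B = seg(y+1, d−1)`), and `Z_{11}Z − Z_{1·}Z_{·1} = −q²(1−a)(1−c)·[T(1,1)T(K,P) − T(K,1)T(1,P)] ≤ 0` by `wheelRimSpoke_trace_form`
(`…AllQWheelWordInv.lean`: the sharpened word invariants `WordInv`, carried by both stretches via `wordInv_seg_mul`).
[cite: Grimmett2006, §1.4 eq. (1.20) (p. 15); §3.9 eq. (3.94), Conj. (3.96) (pp. 63–66)] [cite: Wagner2006, Thm. 5.8, §5.3 (pp. 14–15)]
-/

noncomputable section

namespace Summit.CriticalPhenomena.PercolationContinuityZ3.Theorems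

namespace FK

namespace Wheel

open Matrix WheelTM Literature.Probability.LatticeModels Literature.Probability.Percolation
open Literature.Probability.Percolation.DecisionTree (ind ind_of_mem ind_of_not_mem ind_nonneg)
open scoped Classical

variable {V : Type*} [Fintype V]

/-- **Transfer words carry the sharpened invariants**: `WordInv q ρ M → WordInv q (∏ r_j(1−p_j) · ρ) (seg a ℓ · M)` for parameters in `[0,1]`,
`0 < q ≤ 1`. (transcription of bschramm/prim-bschramm-fk-3/WHEELS-HUB-NC.md §10) -/
theorem wordInv_seg_mul {q : ℝ} (hq0 : 0 < q) (hq1 : q ≤ 1) {p r : ℕ → ℝ} (hp : ∀ j, 0 ≤ p j ∧ p j ≤ 1) (hr : ∀ j, 0 ≤ r j ∧ r j ≤ 1)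
    (n a : ℕ) {ρ : ℝ} {M : Matrix (Fin 2) (Fin 2) ℝ} (hM : WordInv q ρ M) (ℓ : ℕ) :
    WordInv q ((∏ i ∈ Finset.range ℓ, (r ((a + i) % n) * (1 - p ((a + i) % n)))) * ρ) (seg q p r n a ℓ * M) := by
  induction ℓ with
  | zero => simpa [seg_zero] using hM
  | succ ℓ ih =>
    rw [Finset.prod_range_succ, seg_succ, Matrix.mul_assoc]
    unfold letter
    rw [Matrix.mul_assoc]
    have h1 := ih.spoke_mul hq0 hq1 (hp ((a + ℓ) % n)).1 (hp ((a + ℓ) % n)).2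
    have h2 := h1.edge_mul hq0 hq1 (hr ((a + ℓ) % n)).1 (hr ((a + ℓ) % n)).2
    convert h2 using 1
    ring

/-! ### THEOREM W″ -/

section Main

variable {x : V} {v : ℕ → V} {n : ℕ}
variable (hn : 3 ≤ n) (hinj : ∀ j k, j < n → k < n → v j = v k → j = k) (hx : ∀ j, j < n → v j ≠ x) (hcard : Fintype.card V = n + 1)
include hn hinj hx hcard

omit [Fintype V] hcard in
/-- **The partition function through the mixed two-slot functional**: for `w` with the rim pair of `v y` re-pinned to `a'` and the spoke of `v (y+d)`
re-pinned to `b'` (`1 ≤ d ≤ n−1`), `Z = q·(Tr(E(a')·A·S(b')·B) − (2−q)·(ρ_Aρ_B)·(a'(1−b')))` with `A = S(p_y)·seg (y+d+1) (n−d−1)·E(r_{y+d})`,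
`B = seg (y+1) (d−1)` and `ρ_A, ρ_B` their weight products. [folklore] -/
theorem transferT_two_slot_mixed (q : ℝ) (w : Sym2 V → unitInterval) {y d : ℕ} (hy : y < n) (hd1 : 1 ≤ d) (hdn : d + 1 ≤ n)
    (a' b' : unitInterval) :
    transferT q (Function.update (Function.update w (rimPair v n y) a') (spokePair x v n (y + d)) b') x v n =
      q * ((edgeM q (a' : ℝ) * (spokeM (pOf w x v n y) * (seg q (pOf w x v n) (rOf w v n) n (y + d + 1) (n - d - 1) *
              edgeM q (rOf w v n ((y + d) % n)))) * spokeM (b' : ℝ) * seg q (pOf w x v n) (rOf w v n) n (y + 1) (d - 1)).trace -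
        (2 - q) * (((1 - pOf w x v n y) * ((∏ i ∈ Finset.range (n - d - 1),
              (rOf w v n ((y + d + 1 + i) % n) * (1 - pOf w x v n ((y + d + 1 + i) % n)))) * rOf w v n ((y + d) % n))) *
            (∏ i ∈ Finset.range (d - 1), (rOf w v n ((y + 1 + i) % n) * (1 - pOf w x v n ((y + 1 + i) % n))))) *
          ((a' : ℝ) * (1 - (b' : ℝ)))) := by
  have hn1 : 1 ≤ n := by omega
  have hzlt : (y + d) % n < n := Nat.mod_lt _ (by omega)
  have hymod : y % n = y := Nat.mod_eq_of_lt hy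
  have hyz : (y + d) % n ≠ y := fun h => mod_add_ne_mod (i := y) (t := d) (n := n) (by omega) (by omega) (h.trans hymod.symm)
  have hspz : spokePair x v n (y + d) = spokePair x v n ((y + d) % n) := (spokePair_mod x v n (y + d)).symm
  -- letters of the re-pinned weight vector
  have hL₁ := letter_update_rim hn hinj hx q w hy a'
  have hL : ∀ j, letter q (pOf (Function.update (Function.update w (rimPair v n y) a') (spokePair x v n (y + d)) b') x v n)
      (rOf (Function.update (Function.update w (rimPair v n y) a') (spokePair x v n (y + d)) b') v n) n j =
      if j % n = (y + d) % n then edgeM q (rOf (Function.update w (rimPair v n y) a') v n ((y + d) % n)) * spokeM (b' : ℝ)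
      else letter q (pOf (Function.update w (rimPair v n y) a') x v n) (rOf (Function.update w (rimPair v n y) a') v n) n j := by
    intro j
    rw [hspz]
    exact letter_update_spoke hn hinj hx q _ hzlt b' j
  have hr₁ : ∀ j, rOf (Function.update w (rimPair v n y) a') v n j = if j % n = y then (a' : ℝ) else rOf w v n j :=
    fun j => rOf_update_rim hn hinj w hy a' j
  have hp₁ : ∀ j, pOf (Function.update w (rimPair v n y) a') x v n j = pOf w x v n j := fun j => pOf_update_rim hn hx w y a' j
  -- unpinned letters
  have hLw : ∀ j, j % n ≠ y → j % n ≠ (y + d) % n →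
      letter q (pOf (Function.update (Function.update w (rimPair v n y) a') (spokePair x v n (y + d)) b') x v n)
        (rOf (Function.update (Function.update w (rimPair v n y) a') (spokePair x v n (y + d)) b') v n) n j =
      letter q (pOf w x v n) (rOf w v n) n j := by
    intro j h1 h2
    rw [hL j, if_neg h2, hL₁ j, if_neg h1]
  have hLy : letter q (pOf (Function.update (Function.update w (rimPair v n y) a') (spokePair x v n (y + d)) b') x v n)
      (rOf (Function.update (Function.update w (rimPair v n y) a') (spokePair x v n (y + d)) b') v n) n y =
      edgeM q (a' : ℝ) * spokeM (pOf w x v n y) := by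
    rw [hL y, if_neg (by rw [hymod]; exact fun h => hyz h.symm), hL₁ y, if_pos hymod]
  have hLz : letter q (pOf (Function.update (Function.update w (rimPair v n y) a') (spokePair x v n (y + d)) b') x v n)
      (rOf (Function.update (Function.update w (rimPair v n y) a') (spokePair x v n (y + d)) b') v n) n (y + d) =
      edgeM q (rOf w v n ((y + d) % n)) * spokeM (b' : ℝ) := by
    rw [hL (y + d), if_pos rfl, hr₁, Nat.mod_mod, if_neg hyz]
  -- abbreviation (propositional, safe for rewriting)
  obtain ⟨u, hu⟩ : ∃ u, u = Function.update (Function.update w (rimPair v n y) a') (spokePair x v n (y + d)) b' := ⟨_, rfl⟩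
  rw [← hu] at hL hLw hLy hLz ⊢
  -- the word read from `y`
  have hword : seg q (pOf u x v n) (rOf u v n) n y n =
      seg q (pOf w x v n) (rOf w v n) n (y + d + 1) (n - d - 1) * (edgeM q (rOf w v n ((y + d) % n)) * spokeM (b' : ℝ)) *
        seg q (pOf w x v n) (rOf w v n) n (y + 1) (d - 1) * (edgeM q (a' : ℝ) * spokeM (pOf w x v n y)) := by
    have e1 : seg q (pOf u x v n) (rOf u v n) n y n = seg q (pOf u x v n) (rOf u v n) n (y + 1) (n - 1) * letter q (pOf u x v n) (rOf u v n) n y := by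
      have := seg_add q (pOf u x v n) (rOf u v n) n y 1 (n - 1)
      rw [show 1 + (n - 1) = n by omega] at this
      rw [this]
      simp only [seg_succ, seg_zero, Matrix.mul_one, Nat.add_zero]
    have e2 : seg q (pOf u x v n) (rOf u v n) n (y + 1) (n - 1) =
        seg q (pOf u x v n) (rOf u v n) n (y + d + 1) (n - d - 1) * letter q (pOf u x v n) (rOf u v n) n (y + d) *
          seg q (pOf u x v n) (rOf u v n) n (y + 1) (d - 1) := by
      have h3 := seg_add q (pOf u x v n) (rOf u v n) n (y + 1) (d - 1) (n - d)
      rw [show d - 1 + (n - d) = n - 1 by omega, show y + 1 + (d - 1) = y + d by omega] at h3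
      have h4 := seg_add q (pOf u x v n) (rOf u v n) n (y + d) 1 (n - d - 1)
      rw [show 1 + (n - d - 1) = n - d by omega] at h4
      rw [h3, h4]
      simp only [seg_succ, seg_zero, Matrix.mul_one, Nat.add_zero]
    have eA : seg q (pOf u x v n) (rOf u v n) n (y + 1) (d - 1) = seg q (pOf w x v n) (rOf w v n) n (y + 1) (d - 1) := by
      refine seg_congr n q _ _ fun j hj hj' => hLw j ?_ ?_
      · obtain ⟨t, rfl⟩ : ∃ t, j = y + t := ⟨j - y, by omega⟩
        exact fun h => mod_add_ne_mod (i := y) (t := t) (n := n) (by omega) (by omega) (h.trans hymod.symm)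
      · obtain ⟨t, ht⟩ : ∃ t, y + d = j + t := ⟨y + d - j, by omega⟩
        rw [ht]; exact fun h => mod_add_ne_mod (i := j) (t := t) (n := n) (by omega) (by omega) h.symm
    have eB : seg q (pOf u x v n) (rOf u v n) n (y + d + 1) (n - d - 1) = seg q (pOf w x v n) (rOf w v n) n (y + d + 1) (n - d - 1) := by
      refine seg_congr n q _ _ fun j hj hj' => hLw j ?_ ?_
      · obtain ⟨t, rfl⟩ : ∃ t, j = y + t := ⟨j - y, by omega⟩
        exact fun h => mod_add_ne_mod (i := y) (t := t) (n := n) (by omega) (by omega) (h.trans hymod.symm)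
      · obtain ⟨t, rfl⟩ : ∃ t, j = y + d + t := ⟨j - (y + d), by omega⟩
        exact mod_add_ne_mod (by omega) (by omega)
    rw [e1, e2, eA, eB, hLy, hLz]
  -- the trace, rotated so that the pinned rim edge leads
  have htr : (seg q (pOf u x v n) (rOf u v n) n y n).trace =
      (edgeM q (a' : ℝ) * (spokeM (pOf w x v n y) * (seg q (pOf w x v n) (rOf w v n) n (y + d + 1) (n - d - 1) *
          edgeM q (rOf w v n ((y + d) % n)))) * spokeM (b' : ℝ) * seg q (pOf w x v n) (rOf w v n) n (y + 1) (d - 1)).trace := by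
    conv_lhs => rw [hword, Matrix.trace_mul_comm]
    simp only [Matrix.mul_assoc]
  -- the correction product: the full-cycle product of `r_j (1 − p_j)` for `u`, read from `y`
  have hru : ∀ j, rOf u v n j = if j % n = y then (a' : ℝ) else rOf w v n j := fun j => by
    rw [hu, rOf_update_spoke hn hx _ (y + d) b' j, hr₁]
  have hpu : ∀ j, pOf u x v n j = if j % n = (y + d) % n then (b' : ℝ) else pOf w x v n j := by
    intro j
    rw [hu, hspz, pOf_update_spoke hn hinj _ hzlt b' j]
    by_cases h : j % n = (y + d) % n
    · rw [if_pos h, if_pos h]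
    · rw [if_neg h, if_neg h, hp₁]
  have hprod : (∏ j ∈ Finset.range n, rOf u v n j) * ∏ j ∈ Finset.range n, (1 - pOf u x v n j) =
      (((1 - pOf w x v n y) * ((∏ i ∈ Finset.range (n - d - 1),
          (rOf w v n ((y + d + 1 + i) % n) * (1 - pOf w x v n ((y + d + 1 + i) % n)))) * rOf w v n ((y + d) % n))) *
        (∏ i ∈ Finset.range (d - 1), (rOf w v n ((y + 1 + i) % n) * (1 - pOf w x v n ((y + 1 + i) % n))))) *
          ((a' : ℝ) * (1 - (b' : ℝ))) := by
    -- reindex the full product to start at `y`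
    have hfull : (∏ j ∈ Finset.range n, rOf u v n j) * ∏ j ∈ Finset.range n, (1 - pOf u x v n j) =
        ∏ i ∈ Finset.range n, (fun m => rOf u v n m * (1 - pOf u x v n m)) ((y + i) % n) := by
      rw [← Finset.prod_mul_distrib]
      symm
      refine Finset.prod_nbij (fun i => (y + i) % n) (fun i _ => Finset.mem_range.2 (Nat.mod_lt _ (by omega))) ?_ ?_ (fun i _ => rfl)
      · intro i hi j hj h
        have hi' := Finset.mem_range.1 (Finset.mem_coe.1 hi)
        have hj' := Finset.mem_range.1 (Finset.mem_coe.1 hj)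
        have h2 := Nat.ModEq.add_left_cancel' y (show (y + i) % n = (y + j) % n from h)
        rw [Nat.ModEq, Nat.mod_eq_of_lt hi', Nat.mod_eq_of_lt hj'] at h2
        exact h2
      · intro m hm
        have hm' := Finset.mem_range.1 (Finset.mem_coe.1 hm)
        refine ⟨(m + n - y) % n, Finset.mem_coe.2 (Finset.mem_range.2 (Nat.mod_lt _ (by omega))), ?_⟩
        show (y + (m + n - y) % n) % n = m
        rw [Nat.add_mod, Nat.mod_mod, ← Nat.add_mod, show y + (m + n - y) = m + n by omega, Nat.add_mod_right,
          Nat.mod_eq_of_lt hm']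
    rw [hfull, show Finset.range n = Finset.range (d + 1 + (n - d - 1)) by congr 1; omega,
      prod_range_split (fun i => (fun m => rOf u v n m * (1 - pOf u x v n m)) ((y + i) % n)) (n - d - 1) hd1]
    -- evaluate the four pieces
    have fy : rOf u v n ((y + 0) % n) * (1 - pOf u x v n ((y + 0) % n)) = (a' : ℝ) * (1 - pOf w x v n y) := by
      rw [Nat.add_zero, hymod, hru, hpu, hymod, if_pos rfl, if_neg (fun h => hyz h.symm)]
    have fz : rOf u v n ((y + d) % n) * (1 - pOf u x v n ((y + d) % n)) = rOf w v n ((y + d) % n) * (1 - (b' : ℝ)) := by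
      rw [hru, hpu, Nat.mod_mod, if_neg hyz, if_pos rfl]
    have fA : ∀ i ∈ Finset.range (d - 1), rOf u v n ((y + (1 + i)) % n) * (1 - pOf u x v n ((y + (1 + i)) % n)) =
        rOf w v n ((y + 1 + i) % n) * (1 - pOf w x v n ((y + 1 + i) % n)) := by
      intro i hi
      have hi' := Finset.mem_range.1 hi
      have hA1 : (y + 1 + i) % n ≠ y := by
        rw [show y + 1 + i = y + (1 + i) by omega]
        exact fun h => mod_add_ne_mod (i := y) (t := 1 + i) (n := n) (by omega) (by omega) (h.trans hymod.symm)
      have hB1 : (y + 1 + i) % n ≠ (y + d) % n := by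
        rw [show y + d = (y + 1 + i) + (d - 1 - i) by omega]
        exact fun h => mod_add_ne_mod (i := y + 1 + i) (t := d - 1 - i) (n := n) (by omega) (by omega) h.symm
      rw [show y + (1 + i) = y + 1 + i by omega, hru, hpu, Nat.mod_mod, if_neg hA1, if_neg hB1]
    have fB : ∀ i ∈ Finset.range (n - d - 1), rOf u v n ((y + (d + 1 + i)) % n) * (1 - pOf u x v n ((y + (d + 1 + i)) % n)) =
        rOf w v n ((y + d + 1 + i) % n) * (1 - pOf w x v n ((y + d + 1 + i) % n)) := by
      intro i hi
      have hi' := Finset.mem_range.1 hi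
      have hA2 : (y + d + 1 + i) % n ≠ y := by
        rw [show y + d + 1 + i = y + (d + 1 + i) by omega]
        exact fun h => mod_add_ne_mod (i := y) (t := d + 1 + i) (n := n) (by omega) (by omega) (h.trans hymod.symm)
      have hB2 : (y + d + 1 + i) % n ≠ (y + d) % n := by
        rw [show y + d + 1 + i = (y + d) + (1 + i) by omega]; exact mod_add_ne_mod (by omega) (by omega)
      rw [show y + (d + 1 + i) = y + d + 1 + i by omega, hru, hpu, Nat.mod_mod, if_neg hA2, if_neg hB2]
    simp only []
    rw [fy, fz, Finset.prod_congr rfl fA, Finset.prod_congr rfl fB]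
    ring
  unfold transferT
  rw [← trace_seg_rotate q _ _ n y hy.le, htr, mul_assoc (2 - q) (∏ j ∈ Finset.range n, rOf u v n j), hprod]
  ring

set_option maxHeartbeats 400000 in
/-- **THEOREM W″ — a rim edge and a spoke of an apex-over-cycle weighted graph are negatively correlated for `0 < q ≤ 1`.**  The rim pair is
`s(v y, v (y+1))`, the spoke `s(x, v ((y + d) % n))` with `1 ≤ d ≤ n − 1` (every rim vertex other than `v y`; `d ≥ 2` are the non-incident spokes).
(transcription of bschramm/prim-bschramm-fk-3/WHEELS-HUB-NC.md §10) -/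
theorem wheel_negCorr_rim_spoke {q : ℝ} (hq0 : 0 < q) (hq1 : q ≤ 1) (w : Sym2 V → unitInterval)
    (hsupp : ∀ e, e ∉ wheelPairs x v n → w e = 0) {y d : ℕ} (hy : y < n) (hd1 : 1 ≤ d) (hdn : d + 1 ≤ n) :
    (rcMeasureW w q ∅).real ({ω : BondConfig V | rimPair v n y ∈ ω} ∩ {ω | spokePair x v n (y + d) ∈ ω}) ≤
      (rcMeasureW w q ∅).real {ω : BondConfig V | rimPair v n y ∈ ω} *
        (rcMeasureW w q ∅).real {ω : BondConfig V | spokePair x v n (y + d) ∈ ω} := by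
  have hzlt : (y + d) % n < n := Nat.mod_lt _ (by omega)
  have hspz : spokePair x v n (y + d) = spokePair x v n ((y + d) % n) := (spokePair_mod x v n (y + d)).symm
  have hfe : spokePair x v n (y + d) ≠ rimPair v n y := spokePair_ne_rimPair hn hx _ _
  have hsupp1 : ∀ (a' b' : unitInterval), ∀ g, g ∉ wheelPairs x v n →
      Function.update (Function.update w (rimPair v n y) a') (spokePair x v n (y + d)) b' g = 0 := by
    intro a' b'
    have h1 := supp_update_rim w hsupp hy a'
    rw [hspz]
    exact supp_update_spoke _ h1 hzlt b'
  -- partition functions of the four pinnings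
  have hZ : ∀ (a' b' : unitInterval),
      rcPartitionFunctionW (Function.update (Function.update w (rimPair v n y) a') (spokePair x v n (y + d)) b') q ∅ =
        transferT q (Function.update (Function.update w (rimPair v n y) a') (spokePair x v n (y + d)) b') x v n :=
    fun a' b' => rcPartitionFunctionW_eq_transferT hn hinj hx hcard q _ (hsupp1 a' b')
  have hT := fun (a' b' : unitInterval) => transferT_two_slot_mixed hn hinj hx q w hy hd1 hdn a' b'
  -- the sharpened invariants of the two stretches
  have hp01 : ∀ j, 0 ≤ pOf w x v n j ∧ pOf w x v n j ≤ 1 := fun j => ⟨(w _).2.1, (w _).2.2⟩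
  have hr01 : ∀ j, 0 ≤ rOf w v n j ∧ rOf w v n j ≤ 1 := fun j => ⟨(w _).2.1, (w _).2.2⟩
  have hIA : WordInv q ((1 - pOf w x v n y) * ((∏ i ∈ Finset.range (n - d - 1),
        (rOf w v n ((y + d + 1 + i) % n) * (1 - pOf w x v n ((y + d + 1 + i) % n)))) * rOf w v n ((y + d) % n)))
      (spokeM (pOf w x v n y) * (seg q (pOf w x v n) (rOf w v n) n (y + d + 1) (n - d - 1) * edgeM q (rOf w v n ((y + d) % n)))) := by
    have h0 := (WordInv.one q).edge_mul hq0 hq1 (hr01 ((y + d) % n)).1 (hr01 ((y + d) % n)).2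
    rw [Matrix.mul_one, mul_one] at h0
    have h1 := wordInv_seg_mul hq0 hq1 hp01 hr01 n (y + d + 1) h0 (n - d - 1)
    exact h1.spoke_mul hq0 hq1 (hp01 y).1 (hp01 y).2
  have hIB : WordInv q (∏ i ∈ Finset.range (d - 1), (rOf w v n ((y + 1 + i) % n) * (1 - pOf w x v n ((y + 1 + i) % n))))
      (seg q (pOf w x v n) (rOf w v n) n (y + 1) (d - 1)) := by
    have h1 := wordInv_seg_mul hq0 hq1 hp01 hr01 n (y + 1) (WordInv.one q) (d - 1)
    rwa [Matrix.mul_one, mul_one] at h1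
  have hTF := wheelRimSpoke_trace_form hq0.le hq1 hIA hIB
  -- abbreviate the stretch data AFTER all the facts are in place
  generalize hA : spokeM (pOf w x v n y) * (seg q (pOf w x v n) (rOf w v n) n (y + d + 1) (n - d - 1) * edgeM q (rOf w v n ((y + d) % n))) = A
    at hT hTF
  generalize hB : seg q (pOf w x v n) (rOf w v n) n (y + 1) (d - 1) = B at hT hTF
  generalize hρA : (1 - pOf w x v n y) * ((∏ i ∈ Finset.range (n - d - 1),
      (rOf w v n ((y + d + 1 + i) % n) * (1 - pOf w x v n ((y + d + 1 + i) % n)))) * rOf w v n ((y + d) % n)) = ρA at hT hTF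
  generalize hρB : (∏ i ∈ Finset.range (d - 1), (rOf w v n ((y + 1 + i) % n) * (1 - pOf w x v n ((y + 1 + i) % n)))) = ρB at hT hTF
  -- the weights of the two pairs
  have ha0 : 0 ≤ ((w (rimPair v n y) : unitInterval) : ℝ) := (w _).2.1
  have ha1 : ((w (rimPair v n y) : unitInterval) : ℝ) ≤ 1 := (w _).2.2
  have hb0 : 0 ≤ ((w (spokePair x v n (y + d)) : unitInterval) : ℝ) := (w _).2.1
  have hb1 : ((w (spokePair x v n (y + d)) : unitInterval) : ℝ) ≤ 1 := (w _).2.2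
  -- masses
  have hZw : rcPartitionFunctionW w q ∅ =
      rcPartitionFunctionW (Function.update (Function.update w (rimPair v n y) (w (rimPair v n y))) (spokePair x v n (y + d))
        (w (spokePair x v n (y + d)))) q ∅ := by
    rw [Function.update_eq_self, Function.update_eq_self]
  have hSe : ∑ ω : BondConfig V, rcWeightW w q ∅ ω * ind {ω : BondConfig V | rimPair v n y ∈ ω} ω =
      ((w (rimPair v n y) : unitInterval) : ℝ) *
        rcPartitionFunctionW (Function.update (Function.update w (rimPair v n y) 1) (spokePair x v n (y + d)) (w (spokePair x v n (y + d)))) q ∅ := by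
    rw [sum_openPair_eq_mul_Z w q (rimPair v n y)]
    congr 2
    conv_lhs => rw [← Function.update_eq_self (spokePair x v n (y + d)) (Function.update w (rimPair v n y) 1)]
    rw [Function.update_of_ne hfe]
  have hSf : ∑ ω : BondConfig V, rcWeightW w q ∅ ω * ind {ω : BondConfig V | spokePair x v n (y + d) ∈ ω} ω =
      ((w (spokePair x v n (y + d)) : unitInterval) : ℝ) *
        rcPartitionFunctionW (Function.update (Function.update w (rimPair v n y) (w (rimPair v n y))) (spokePair x v n (y + d)) 1) q ∅ := by
    rw [sum_openPair_eq_mul_Z w q (spokePair x v n (y + d)), Function.update_eq_self]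
  have hSef : ∑ ω : BondConfig V, rcWeightW w q ∅ ω * ind ({ω : BondConfig V | rimPair v n y ∈ ω} ∩ {ω | spokePair x v n (y + d) ∈ ω}) ω =
      ((w (rimPair v n y) : unitInterval) : ℝ) * ((w (spokePair x v n (y + d)) : unitInterval) : ℝ) *
        rcPartitionFunctionW (Function.update (Function.update w (rimPair v n y) 1) (spokePair x v n (y + d)) 1) q ∅ :=
    sum_openPair_inter_openPair_eq w q hfe
  -- the trace expansion in the entries of `A`, `B`: `E(a) = a·1 + (1−a)·K`, `S(c) = (1−c)·1 + c·P`
  have tES : ∀ a c : ℝ, (edgeM q a * A * spokeM c * B).trace =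
      a * (1 - c) * (A * B).trace + (1 - a) * (1 - c) * ((A * B) 0 1 + q * (A * B) 1 1) + a * c * ((B * A) 0 0 + (B * A) 1 0) +
        (1 - a) * c * ((B 0 1 + B 1 1) * (A 0 0 + q * A 1 0)) := by
    intro a c
    simp only [Matrix.trace_fin_two, Matrix.mul_apply, Fin.sum_univ_two, spokeM_00, spokeM_01, spokeM_10, spokeM_11,
      edgeM_00, edgeM_01, edgeM_10, edgeM_11]
    ring
  -- the main inequality between masses: `S(J_e ∩ J_f)·Z ≤ S(J_e)·S(J_f)`
  have hnn : 0 ≤ q ^ 2 * (((w (rimPair v n y) : unitInterval) : ℝ) * ((w (spokePair x v n (y + d)) : unitInterval) : ℝ)) *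
      ((1 - ((w (rimPair v n y) : unitInterval) : ℝ)) * (1 - ((w (spokePair x v n (y + d)) : unitInterval) : ℝ))) *
      (((B 0 1 + B 1 1) * (A 0 0 + q * A 1 0)) * ((A * B).trace - (2 - q) * ρA * ρB) -
        ((A * B) 0 1 + q * (A * B) 1 1) * ((B * A) 0 0 + (B * A) 1 0)) := by
    apply mul_nonneg
    · exact mul_nonneg (mul_nonneg (sq_nonneg q) (mul_nonneg ha0 hb0)) (mul_nonneg (sub_nonneg.2 ha1) (sub_nonneg.2 hb1))
    · linarith [hTF]
  have key : ∀ (a c tAB tKI tIP tKP ρ : ℝ),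
      (a * (q * (1 * (1 - c) * tAB + (1 - 1) * (1 - c) * tKI + 1 * c * tIP + (1 - 1) * c * tKP - (2 - q) * ρ * (1 * (1 - c))))) *
          (c * (q * (a * (1 - 1) * tAB + (1 - a) * (1 - 1) * tKI + a * 1 * tIP + (1 - a) * 1 * tKP - (2 - q) * ρ * (a * (1 - 1))))) -
        (a * c * (q * (1 * (1 - 1) * tAB + (1 - 1) * (1 - 1) * tKI + 1 * 1 * tIP + (1 - 1) * 1 * tKP - (2 - q) * ρ * (1 * (1 - 1))))) *
          (q * (a * (1 - c) * tAB + (1 - a) * (1 - c) * tKI + a * c * tIP + (1 - a) * c * tKP - (2 - q) * ρ * (a * (1 - c)))) =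
      q ^ 2 * (a * c) * ((1 - a) * (1 - c)) * (tKP * (tAB - (2 - q) * ρ) - tKI * tIP) := by
    intro a c tAB tKI tIP tKP ρ; ring
  have main : (∑ ω : BondConfig V, rcWeightW w q ∅ ω * ind ({ω : BondConfig V | rimPair v n y ∈ ω} ∩ {ω | spokePair x v n (y + d) ∈ ω}) ω) *
      rcPartitionFunctionW w q ∅ ≤
      (∑ ω : BondConfig V, rcWeightW w q ∅ ω * ind {ω : BondConfig V | rimPair v n y ∈ ω} ω) *
        ∑ ω : BondConfig V, rcWeightW w q ∅ ω * ind {ω : BondConfig V | spokePair x v n (y + d) ∈ ω} ω := by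
    rw [hSef, hSe, hSf, hZw, hZ, hZ, hZ, hZ, hT, hT, hT, hT, Set.Icc.coe_one, tES, tES, tES, tES]
    have k := key ((w (rimPair v n y) : unitInterval) : ℝ) ((w (spokePair x v n (y + d)) : unitInterval) : ℝ) (A * B).trace
      ((A * B) 0 1 + q * (A * B) 1 1) ((B * A) 0 0 + (B * A) 1 0) ((B 0 1 + B 1 1) * (A 0 0 + q * A 1 0)) (ρA * ρB)
    nlinarith [k, hnn]
  -- to probabilities
  have hZpos := rcPartitionFunctionW_pos w hq0 (∅ : Set V)
  rw [rcMeasureW_real_eq_sum_div w hq0, rcMeasureW_real_eq_sum_div w hq0, rcMeasureW_real_eq_sum_div w hq0, div_mul_div_comm,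
    div_le_div_iff₀ hZpos (mul_pos hZpos hZpos)]
  nlinarith [mul_le_mul_of_nonneg_right main hZpos.le]

end Main

end Wheel

end FK

end Summit.CriticalPhenomena.PercolationContinuityZ3.Theorems
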